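import Summits.NavierStokesRegularity.FunctionalMining.TopEigSmoothEigenpairParam
import Summits.NavierStokesRegularity.FunctionalMining.TopEigChartCalculus
import HarnessLib

/-!
# FunctionalMining — `λ₁(S(v))` is jointly `C^∞` on the open simple set, and its torus Laplacian at a
# simple point (F1 PART I, Proposition 3, with NO eigenpair input)

Search for candidate a priori estimates; no regularity claim. Cell `pub-nsfunc`, prove seat
(gen 23). `TopEigDensitySimplePoint.lean` (gen 22) gave, at a point `x ∈ T³` where the top strain
eigenvalue is simple in gap form (`S(x)e = λe`, `|e| = 1`, `wᵀS(x)w ≤ (λ − g)|w|²` on `e^⊥`, `g > 0`),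
the directional identities `∂ₖλ₁(x) = eᵀS(∂ₖv)(x)e`, `∂ₖ∂ₖλ₁(x) = eᵀS(∂ₖ∂ₖv)(x)e + 2N′ₖᵀS(∂ₖv)(x)e`
and `∑ₖ ∂ₖ∂ₖλ₁(x) ≥ eᵀS(Δv)(x)e`, leaving open whether `∑ₖ∂ₖ∂ₖ` is the torus Laplacian there (joint
smoothness of `λ₁` in `x`). Here that input is supplied by the `d`-parameter implicit-function step
(`TopEigSmoothEigenpairParam`) read in the chart `w ↦ x + proj w`:

* **`TopEig.exists_smooth_topEigenvector_chart_of_gapForm`** — a unit top-eigenvector field `N`,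
  `C^∞` at `0` in the chart, `N(0) = e`, with `S(v)(x + proj w)N(w) = λ₁(x + proj w)N(w)` and the gap
  form (gap `g/2`) for `w` near `0`; and **`liftAt λ₁ x` is `C^∞` at `0`** (`λ₁ = torusStrainTopEig v`);
* `TopEig.eventually_nhds_gapForm` — THE SIMPLE SET IS OPEN (torus neighbourhoods);
  `TopEig.eventually_contDiffAt_liftAt_torusStrainTopEig_of_gapForm` — `λ₁` is `C^∞` on a
  neighbourhood of `x`;
* **`TopEig.laplacian_torusStrainTopEig_eq_of_gapForm`** — `Δλ₁(x) = eᵀS(Δv)(x)e + 2∑ₖN′ₖᵀS(∂ₖv)(x)e`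
  with the channels `N′ₖᵀS(∂ₖv)e = λ|N′ₖ|² − N′ₖᵀS(x)N′ₖ ≥ 0` (now with the genuine torus Laplacian),
  `TopEig.laplacian_torusStrainTopEig_ge_of_gapForm` — `Δλ₁(x) ≥ eᵀS(Δv)(x)e`;
* `TopEig.lam_pos_of_gapForm_of_isDivFree` — for divergence-free `v`, `λ₁ ≥ 2g/3 > 0` at a simple
  point; `TopEig.exists_smooth_topProjector_chart_of_gapForm` — the projector `e₁ ⊗ e₁` is `C^∞` near
  a simple point (sign-free form of the smooth eigenvector).

The density identity (2) itself (`Δ(λ₁^q)` and `ρ_{e₁} = F_q − Δ(λ₁^q)` at the point) is the sequel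
`TopEigDensityLocalIdentity.lean`.

Nothing here is about Navier–Stokes dynamics; it is static calculus of `v ↦ λ₁(sym ∇v)` on `T³`.
[ours; folklore — Kato II-§5]
-/

noncomputable section

open Filter Topology Matrix
open scoped ContDiff

namespace Summit.NavierStokesRegularity.FunctionalMining

open Literature.Analysis Literature.Analysis.FunctionSpaces Literature.Analysis.FunctionSpaces.Torus
  SharpClass.DirectorForm

namespace TopEig

variable {v : UnitAddTorus (Fin 3) → EuclideanSpace ℝ (Fin 3)}

/-! ## 1. The strain in the chart at a point -/

/-- The strain of a smooth field read in the chart at `x`, `w ↦ S(v)(x + proj w)`, is entrywise `C^∞`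
on `ℝ³`. [folklore] -/
theorem contDiff_torusStrainMatrix_chart (hv : Torus.IsSmooth v) (x : UnitAddTorus (Fin 3))
    (i j : Fin 3) :
    ContDiff ℝ ∞ fun w : EuclideanSpace ℝ (Fin 3) => torusStrainMatrix v (x + proj w) i j :=
  (isSmooth_torusStrainMatrix_entry hv i j).liftAt x

/-- `λ₁` of the chart family is the chart of `torusStrainTopEig`. [ours, bookkeeping] -/
theorem lam1_torusStrainMatrix_chart (v : UnitAddTorus (Fin 3) → EuclideanSpace ℝ (Fin 3))
    (x : UnitAddTorus (Fin 3)) :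
    (fun w : EuclideanSpace ℝ (Fin 3) => lam1 (torusStrainMatrix v (x + proj w))) =
      liftAt (torusStrainTopEig v) x := by
  funext w
  exact lam1_torusStrainMatrix v _

/-- At a simple point in gap form the eigenvalue `λ` IS `torusStrainTopEig v x`. [ours, bookkeeping] -/
theorem torusStrainTopEig_eq_of_gapForm {x : UnitAddTorus (Fin 3)} {e : Fin 3 → ℝ} {lam g : ℝ}
    (he1 : e ⬝ᵥ e = 1) (hSe : torusStrainMatrix v x *ᵥ e = lam • e) (hg : 0 < g)
    (hgap : ∀ w, w ⬝ᵥ e = 0 → w ⬝ᵥ torusStrainMatrix v x *ᵥ w ≤ (lam - g) * (w ⬝ᵥ w)) :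
    torusStrainTopEig v x = lam := by
  rw [← lam1_torusStrainMatrix]
  have he1' : e ∈ unitSphere (Fin 3) := he1
  exact lam_eq_of_gapForm he1' hg.le
    (gapForm_of_eigenvector (torusStrainMatrix_isSymm v x) he1' hSe hgap)
    (by rw [quad_flat, hSe, dotProduct_smul, he1, smul_eq_mul, mul_one])

/-- **A simple top eigenvalue of a TRACELESS symmetric `3 × 3` matrix is positive**: in gap form with
gap `g`, `λ ≥ 2g/3` (test the gap form at the three coordinate vectors and add: `0 = tr S ≤ 3λ − 2g`).
[folklore] -/
theorem lam_ge_of_gapForm_of_trace_eq_zero {S : Matrix (Fin 3) (Fin 3) ℝ} (hS : S.IsSymm)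
    {e : Fin 3 → ℝ} {lam g : ℝ} (he1 : e ⬝ᵥ e = 1) (hSe : S *ᵥ e = lam • e)
    (hgap : ∀ w, w ⬝ᵥ e = 0 → w ⬝ᵥ S *ᵥ w ≤ (lam - g) * (w ⬝ᵥ w)) (htr : S.trace = 0) :
    2 * g / 3 ≤ lam := by
  have he1' : e ∈ unitSphere (Fin 3) := he1
  have hgf := gapForm_of_eigenvector hS he1' hSe hgap
  have hb : ∀ i : Fin 3, S i i ≤ lam - g * (1 - e i ^ 2) := by
    intro i
    have hmem : (Pi.single i (1 : ℝ) : Fin 3 → ℝ) ∈ unitSphere (Fin 3) := by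
      show Pi.single i (1 : ℝ) ⬝ᵥ Pi.single i 1 = 1
      simp
    have h := hgf _ hmem
    rw [quad_flat] at h
    fin_cases i <;>
      simpa [dotProduct, Matrix.mulVec, Fin.sum_univ_three, Pi.single_apply] using h
  rw [Matrix.trace_fin_three] at htr
  have hs : e 0 ^ 2 + e 1 ^ 2 + e 2 ^ 2 = 1 := by
    have h := he1
    simp only [dotProduct, Fin.sum_univ_three] at h
    nlinarith [h]
  have hg' : g * (1 - e 0 ^ 2) + g * (1 - e 1 ^ 2) + g * (1 - e 2 ^ 2) = 2 * g := by
    linear_combination (-g) * hs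
  linarith [hb 0, hb 1, hb 2, hg', htr]

/-- **At a simple point of the strain of a DIVERGENCE-FREE field, `λ₁ ≥ 2g/3 > 0`** (`tr S = div v = 0`;
F1 PART I Prop. 3: "then `λ₁ > 0` on `U`, since `λ₁ = 0` forces `S = 0`"). [ours] -/
theorem lam_pos_of_gapForm_of_isDivFree (hv : Torus.IsSmooth v) (hdiv : Torus.IsDivFree v)
    {x : UnitAddTorus (Fin 3)} {e : Fin 3 → ℝ} {lam g : ℝ} (he1 : e ⬝ᵥ e = 1)
    (hSe : torusStrainMatrix v x *ᵥ e = lam • e) (hg : 0 < g)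
    (hgap : ∀ w, w ⬝ᵥ e = 0 → w ⬝ᵥ torusStrainMatrix v x *ᵥ w ≤ (lam - g) * (w ⬝ᵥ w)) :
    2 * g / 3 ≤ lam ∧ 0 < lam := by
  have h := lam_ge_of_gapForm_of_trace_eq_zero (torusStrainMatrix_isSymm v x) he1 hSe hgap
    (torusStrainMatrix_trace_eq_zero hv hdiv x)
  exact ⟨h, by linarith⟩

/-! ## 2. Joint smoothness of `λ₁` at a simple point; the simple set is open -/

/-- **JOINT SMOOTHNESS OF `λ₁` AND A SMOOTH TOP-EIGENVECTOR FIELD AT A SIMPLE POINT.** For a smooth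
field `v` on `T³` and a point `x` where the top strain eigenvalue is simple in gap form at the unit
vector `e` (gap `g > 0`): there is `N : ℝ³ → ℝ³`, `C^∞` at `0`, `N(0) = e`, such that for `w` near `0`
(chart at `x`) `S(v)(x + proj w)N(w) = λ₁(x + proj w)N(w)`, `|N(w)| = 1`, `N(w)` is a top vector and
the gap form holds at `N(w)` with gap `g/2`; and the chart `liftAt λ₁ x : w ↦ λ₁(x + proj w)` of
`λ₁ = torusStrainTopEig v` is `C^∞` at `0`. (F1 PART I Prop. 3, the implicit-function step in `x`.)
[ours; folklore — Kato II-§5] -/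
theorem exists_smooth_topEigenvector_chart_of_gapForm (hv : Torus.IsSmooth v)
    {x : UnitAddTorus (Fin 3)} {e : Fin 3 → ℝ} {lam g : ℝ} (he1 : e ⬝ᵥ e = 1)
    (hSe : torusStrainMatrix v x *ᵥ e = lam • e) (hg : 0 < g)
    (hgap : ∀ w, w ⬝ᵥ e = 0 → w ⬝ᵥ torusStrainMatrix v x *ᵥ w ≤ (lam - g) * (w ⬝ᵥ w)) :
    ∃ N : EuclideanSpace ℝ (Fin 3) → Fin 3 → ℝ, ContDiffAt ℝ ∞ N 0 ∧ N 0 = e ∧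
      (∀ᶠ w in 𝓝 (0 : EuclideanSpace ℝ (Fin 3)),
        torusStrainMatrix v (x + proj w) *ᵥ N w = torusStrainTopEig v (x + proj w) • N w ∧
        N w ⬝ᵥ N w = 1 ∧ N w ∈ topEigSet (StrainL4.strainFlat v (x + proj w)) ∧
        ∀ u, u ⬝ᵥ N w = 0 → u ⬝ᵥ torusStrainMatrix v (x + proj w) *ᵥ u ≤
          (torusStrainTopEig v (x + proj w) - g / 2) * (u ⬝ᵥ u)) ∧
      ContDiffAt ℝ ∞ (liftAt (torusStrainTopEig v) x) 0 := by
  have hSs : ∀ i j, ContDiff ℝ ∞ fun w : EuclideanSpace ℝ (Fin 3) => torusStrainMatrix v (x + proj w) i j :=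
    fun i j => contDiff_torusStrainMatrix_chart hv x i j
  have hSsymm : ∀ w : EuclideanSpace ℝ (Fin 3), (torusStrainMatrix v (x + proj w)).IsSymm :=
    fun w => torusStrainMatrix_isSymm v _
  have hx0 : x + proj (0 : EuclideanSpace ℝ (Fin 3)) = x := by rw [proj_zero, add_zero]
  have hSe' : torusStrainMatrix v (x + proj (0 : EuclideanSpace ℝ (Fin 3))) *ᵥ e = lam • e := by
    rw [hx0]; exact hSe
  have hgap' : ∀ w, w ⬝ᵥ e = 0 →
      w ⬝ᵥ torusStrainMatrix v (x + proj (0 : EuclideanSpace ℝ (Fin 3))) *ᵥ w ≤ (lam - g) * (w ⬝ᵥ w) := by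
    intro w hw; rw [hx0]; exact hgap w hw
  obtain ⟨N, hN, hN0, hev, hcd⟩ :=
    contDiffAt_lam1_of_gapForm_param (S := fun w => torusStrainMatrix v (x + proj w)) (θ₀ := 0)
      hSs hSsymm he1 hSe' hg hgap'
  refine ⟨N, hN, hN0, ?_, ?_⟩
  · filter_upwards [hev] with w hw
    obtain ⟨h1, h2, h3, h4⟩ := hw
    rw [lam1_torusStrainMatrix] at h1 h4
    rw [flat_torusStrainMatrix] at h3
    exact ⟨h1, h2, h3, h4⟩
  · rw [lam1_torusStrainMatrix_chart] at hcd
    exact hcd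

/-- **THE SIMPLE SET IS OPEN.** Near a point where `λ₁(S(v))` is simple in gap form with gap `g`, every
point `y` carries a unit top eigenvector `e′` with `S(v)(y)e′ = λ₁(y)e′` and the gap form with gap
`g/2` (torus neighbourhoods). [ours; folklore — Kato II-§5] -/
theorem eventually_nhds_gapForm (hv : Torus.IsSmooth v)
    {x : UnitAddTorus (Fin 3)} {e : Fin 3 → ℝ} {lam g : ℝ} (he1 : e ⬝ᵥ e = 1)
    (hSe : torusStrainMatrix v x *ᵥ e = lam • e) (hg : 0 < g)
    (hgap : ∀ w, w ⬝ᵥ e = 0 → w ⬝ᵥ torusStrainMatrix v x *ᵥ w ≤ (lam - g) * (w ⬝ᵥ w)) :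
    ∀ᶠ y in 𝓝 x, ∃ e' : Fin 3 → ℝ, e' ⬝ᵥ e' = 1 ∧
      torusStrainMatrix v y *ᵥ e' = torusStrainTopEig v y • e' ∧
      ∀ u, u ⬝ᵥ e' = 0 → u ⬝ᵥ torusStrainMatrix v y *ᵥ u ≤ (torusStrainTopEig v y - g / 2) * (u ⬝ᵥ u) := by
  obtain ⟨N, -, -, hev, -⟩ := exists_smooth_topEigenvector_chart_of_gapForm hv he1 hSe hg hgap
  refine eventually_nhds_of_chart ?_
  filter_upwards [hev] with w hw
  exact ⟨N w, hw.2.1, hw.1, hw.2.2.2⟩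

/-- **`λ₁` IS `C^∞` ON A NEIGHBOURHOOD OF A SIMPLE POINT**: in the chart at `x`, `liftAt λ₁ x` is
`C^∞` at every `w` near `0`. [ours; folklore — Kato II-§5] -/
theorem eventually_contDiffAt_liftAt_torusStrainTopEig_of_gapForm (hv : Torus.IsSmooth v)
    {x : UnitAddTorus (Fin 3)} {e : Fin 3 → ℝ} {lam g : ℝ} (he1 : e ⬝ᵥ e = 1)
    (hSe : torusStrainMatrix v x *ᵥ e = lam • e) (hg : 0 < g)
    (hgap : ∀ w, w ⬝ᵥ e = 0 → w ⬝ᵥ torusStrainMatrix v x *ᵥ w ≤ (lam - g) * (w ⬝ᵥ w)) :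
    ∀ᶠ w in 𝓝 (0 : EuclideanSpace ℝ (Fin 3)), ContDiffAt ℝ ∞ (liftAt (torusStrainTopEig v) x) w := by
  obtain ⟨N, -, -, hev, -⟩ := exists_smooth_topEigenvector_chart_of_gapForm hv he1 hSe hg hgap
  filter_upwards [hev] with w hw
  obtain ⟨h1, h2, -, h4⟩ := hw
  have hg2 : 0 < g / 2 := by positivity
  obtain ⟨-, -, -, -, hcd⟩ := exists_smooth_topEigenvector_chart_of_gapForm hv h2 h1 hg2 h4
  exact contDiffAt_liftAt_of_shift hcd

/-- **THE SPECTRAL PROJECTOR `e₁ ⊗ e₁` IS `C^∞` NEAR A SIMPLE POINT** (Prop. 3: `e₁⊗e₁ ∈ C^∞(U)`, the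
sign-free object): with `N` the smooth top-eigenvector field of the previous theorem,
`P(w) := N(w) ⊗ N(w)` is entrywise `C^∞` at `0` in the chart, `P(0) = e ⊗ e`, and for `w` near `0`
EVERY unit top eigenvector `f` of `S(v)(x + proj w)` has `f ⊗ f = P(w)` (the top eigen-set is `{±N(w)}`).
[ours; folklore — Kato II-§5] -/
theorem exists_smooth_topProjector_chart_of_gapForm (hv : Torus.IsSmooth v)
    {x : UnitAddTorus (Fin 3)} {e : Fin 3 → ℝ} {lam g : ℝ} (he1 : e ⬝ᵥ e = 1)
    (hSe : torusStrainMatrix v x *ᵥ e = lam • e) (hg : 0 < g)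
    (hgap : ∀ w, w ⬝ᵥ e = 0 → w ⬝ᵥ torusStrainMatrix v x *ᵥ w ≤ (lam - g) * (w ⬝ᵥ w)) :
    ∃ P : EuclideanSpace ℝ (Fin 3) → Matrix (Fin 3) (Fin 3) ℝ,
      (∀ i j, ContDiffAt ℝ ∞ (fun w => P w i j) 0) ∧ P 0 = Matrix.vecMulVec e e ∧
      ∀ᶠ w in 𝓝 (0 : EuclideanSpace ℝ (Fin 3)),
        ∀ f ∈ topEigSet (StrainL4.strainFlat v (x + proj w)), Matrix.vecMulVec f f = P w := by
  obtain ⟨N, hN, hN0, hev, -⟩ := exists_smooth_topEigenvector_chart_of_gapForm hv he1 hSe hg hgap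
  refine ⟨fun w => Matrix.vecMulVec (N w) (N w), ?_, by simp [hN0], ?_⟩
  · intro i j
    simp only [Matrix.vecMulVec_apply]
    exact (contDiffAt_pi.1 hN i).mul (contDiffAt_pi.1 hN j)
  · filter_upwards [hev] with w hw
    obtain ⟨h1, h2, -, h4⟩ := hw
    intro f hf
    have hN1 : N w ∈ unitSphere (Fin 3) := h2
    have hg2 : 0 < g / 2 := by positivity
    have hquad : quad (flat (torusStrainMatrix v (x + proj w))) (N w) = torusStrainTopEig v (x + proj w) := by
      rw [quad_flat, h1, dotProduct_smul, h2, smul_eq_mul, mul_one]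
    have hpair := topEigSet_eq_pair_of_gapForm hN1 hg2
      (gapForm_of_eigenvector (torusStrainMatrix_isSymm v _) hN1 h1 h4) hquad
    rw [← flat_torusStrainMatrix, hpair] at hf
    rcases hf with hf | hf
    · rw [hf]
    · rw [hf]
      ext i j
      simp [Matrix.vecMulVec_apply]

/-! ## 3. The torus Laplacian of `λ₁` at a simple point -/

/-- At a simple point `Δλ₁(x) = ∑ₖ ∂ₖ∂ₖλ₁(x)` (`λ₁` is `C^∞` around `x`). [ours] -/
theorem laplacian_torusStrainTopEig_eq_sum_of_gapForm (hv : Torus.IsSmooth v)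
    {x : UnitAddTorus (Fin 3)} {e : Fin 3 → ℝ} {lam g : ℝ} (he1 : e ⬝ᵥ e = 1)
    (hSe : torusStrainMatrix v x *ᵥ e = lam • e) (hg : 0 < g)
    (hgap : ∀ w, w ⬝ᵥ e = 0 → w ⬝ᵥ torusStrainMatrix v x *ᵥ w ≤ (lam - g) * (w ⬝ᵥ w)) :
    Torus.laplacian (torusStrainTopEig v) x =
      ∑ k, Torus.partialDeriv k (Torus.partialDeriv k (torusStrainTopEig v)) x := by
  obtain ⟨-, -, -, -, hcd⟩ := exists_smooth_topEigenvector_chart_of_gapForm hv he1 hSe hg hgap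
  exact laplacian_eq_sum_partialDeriv_partialDeriv_of_contDiffAt (hcd.of_le (WithTop.coe_le_coe.2 le_top))

/-- **`Δλ₁(x) ≥ eᵀS(Δv)(x)e` at a simple point** (the channels are non-negative). [ours; F1 PART I
Prop. 3 (2)] -/
theorem laplacian_torusStrainTopEig_ge_of_gapForm (hv : Torus.IsSmooth v)
    {x : UnitAddTorus (Fin 3)} {e : Fin 3 → ℝ} {lam g : ℝ} (he1 : e ⬝ᵥ e = 1)
    (hSe : torusStrainMatrix v x *ᵥ e = lam • e) (hg : 0 < g)
    (hgap : ∀ w, w ⬝ᵥ e = 0 → w ⬝ᵥ torusStrainMatrix v x *ᵥ w ≤ (lam - g) * (w ⬝ᵥ w)) :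
    e ⬝ᵥ (torusStrainMatrix (Torus.laplacian v) x *ᵥ e) ≤ Torus.laplacian (torusStrainTopEig v) x := by
  rw [laplacian_torusStrainTopEig_eq_sum_of_gapForm hv he1 hSe hg hgap]
  exact sum_partialDeriv_partialDeriv_torusStrainTopEig_ge hv he1 hSe hg hgap

/-- **PROPOSITION 3 AT A SIMPLE POINT, LAPLACIAN FORM, NO EIGENPAIR INPUT.** For a smooth field `v`
on `T³` and a point `x` where `λ₁(S(v))` is simple in gap form at `e`: there are vectors `N′ₖ ∈ ℝ³`
(the derivatives along `eₖ` of the continued unit top eigenvector) with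
`Δλ₁(x) = eᵀS(Δv)(x)e + 2∑ₖ N′ₖᵀS(∂ₖv)(x)e`, and for every `k`: `∂ₖλ₁(x) = eᵀS(∂ₖv)(x)e`,
`∂ₖ∂ₖλ₁(x) = eᵀS(∂ₖ∂ₖv)(x)e + 2N′ₖᵀS(∂ₖv)(x)e`, `N′ₖᵀS(∂ₖv)(x)e = λ|N′ₖ|² − N′ₖᵀS(x)N′ₖ ≥ 0`.
[ours; F1 PART I Prop. 3 (2)] -/
theorem laplacian_torusStrainTopEig_eq_of_gapForm (hv : Torus.IsSmooth v)
    {x : UnitAddTorus (Fin 3)} {e : Fin 3 → ℝ} {lam g : ℝ} (he1 : e ⬝ᵥ e = 1)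
    (hSe : torusStrainMatrix v x *ᵥ e = lam • e) (hg : 0 < g)
    (hgap : ∀ w, w ⬝ᵥ e = 0 → w ⬝ᵥ torusStrainMatrix v x *ᵥ w ≤ (lam - g) * (w ⬝ᵥ w)) :
    ∃ N' : Fin 3 → Fin 3 → ℝ,
      Torus.laplacian (torusStrainTopEig v) x =
        e ⬝ᵥ (torusStrainMatrix (Torus.laplacian v) x *ᵥ e) +
          2 * ∑ k, N' k ⬝ᵥ (torusStrainMatrix (Torus.partialDeriv k v) x *ᵥ e) ∧
      ∀ k, Torus.partialDeriv k (torusStrainTopEig v) x =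
          e ⬝ᵥ (torusStrainMatrix (Torus.partialDeriv k v) x *ᵥ e) ∧
        Torus.partialDeriv k (Torus.partialDeriv k (torusStrainTopEig v)) x =
          e ⬝ᵥ (torusStrainMatrix (Torus.partialDeriv k (Torus.partialDeriv k v)) x *ᵥ e) +
            2 * (N' k ⬝ᵥ (torusStrainMatrix (Torus.partialDeriv k v) x *ᵥ e)) ∧
        N' k ⬝ᵥ (torusStrainMatrix (Torus.partialDeriv k v) x *ᵥ e) =
          lam * (N' k ⬝ᵥ N' k) - N' k ⬝ᵥ (torusStrainMatrix v x *ᵥ N' k) ∧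
        0 ≤ N' k ⬝ᵥ (torusStrainMatrix (Torus.partialDeriv k v) x *ᵥ e) := by
  have hk := fun k => partialDeriv_partialDeriv_torusStrainTopEig_of_gapForm hv he1 hSe hg hgap k
  choose N' hN' using hk
  refine ⟨N', ?_, hN'⟩
  rw [laplacian_torusStrainTopEig_eq_sum_of_gapForm hv he1 hSe hg hgap]
  have hsum : ∑ k, Torus.partialDeriv k (Torus.partialDeriv k (torusStrainTopEig v)) x =
      ∑ k, (e ⬝ᵥ (torusStrainMatrix (Torus.partialDeriv k (Torus.partialDeriv k v)) x *ᵥ e) +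
        2 * (N' k ⬝ᵥ (torusStrainMatrix (Torus.partialDeriv k v) x *ᵥ e))) :=
    Finset.sum_congr rfl fun k _ => (hN' k).2.1
  have hlap : e ⬝ᵥ (torusStrainMatrix (Torus.laplacian v) x *ᵥ e) =
      ∑ k, e ⬝ᵥ (torusStrainMatrix (Torus.partialDeriv k (Torus.partialDeriv k v)) x *ᵥ e) := by
    calc e ⬝ᵥ (torusStrainMatrix (Torus.laplacian v) x *ᵥ e)
        = ∑ i, ∑ j, e i * torusStrainMatrix (Torus.laplacian v) x i j * e j :=
          dotProduct_mulVec_eq_sum_sum _ _ _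
      _ = ∑ i, ∑ j, ∑ k, e i * torusStrainMatrix (Torus.partialDeriv k (Torus.partialDeriv k v)) x i j * e j := by
          refine Finset.sum_congr rfl fun i _ => Finset.sum_congr rfl fun j _ => ?_
          rw [← torusStrainMatrix_laplacian hv x i j, Finset.mul_sum, Finset.sum_mul]
      _ = ∑ k, ∑ i, ∑ j, e i * torusStrainMatrix (Torus.partialDeriv k (Torus.partialDeriv k v)) x i j * e j := by
          rw [Finset.sum_congr rfl fun i _ => Finset.sum_comm, Finset.sum_comm]
      _ = ∑ k, e ⬝ᵥ (torusStrainMatrix (Torus.partialDeriv k (Torus.partialDeriv k v)) x *ᵥ e) :=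
          Finset.sum_congr rfl fun k _ => (dotProduct_mulVec_eq_sum_sum _ _ _).symm
  rw [hsum, Finset.sum_add_distrib, Finset.mul_sum, hlap]

end TopEig

end Summit.NavierStokesRegularity.FunctionalMining

end
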